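import Mathlib
import Summits.KontsevichZagierPeriods.Zeta5Search.ThirdOrderDeepPair
import Summits.KontsevichZagierPeriods.Zeta5Search.ThirdOrderRaisePair
import Summits.KontsevichZagierPeriods.Zeta5Search.ThirdOrderDoublePair
import Summits.KontsevichZagierPeriods.Zeta5Search.SecondOrderAssembly
import HarnessLib

/-!
# ζ(5) search — THEOREM A⁗, aggregation: `2·(W/(−p)^{m+3}, V/(−p)^m) ≡ A·τ(T) (mod p³)`, `‖A‖ ≤ p⁻¹`

Cell `pub-zeta5` (HONEST FRAMING: systematic search; no irrationality claim unless certified), typer seat generation 12.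
REPORT-gen2-g10 §6.5, the step "every orbit contributes to `Σ_x (Ω,N)_x` an exact scalar multiple of the fixed vector `τ(T)` plus
`O(p³)`": under the class hypotheses of `SecondOrder.LawA4` for ONE parameter vector (`m = −M`), every residue `x < p` together with
its conjugate contributes `a_x·τ(T) + O(p³)` with ONE scalar `a_x`, `‖a_x‖ ≤ p⁻¹` (`pair₃`: deep pairs `deep_pair₃`, raise pairs
`raise_pair₃`, doubly raised pairs `double_pair₃`, everything else `rest3W_norm`/`rest3V_norm`), hence by the conjugation
symmetrisation `2Σ_x F(x) = Σ_x (F(x) + F(x̄))` the aggregate satisfies `2(W/(−p)^{m+3}) ≡ A τ_W`, `2(V/(−p)^m) ≡ A τ_V (mod p³)`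
with `A = Σ a_x` (`aggregate₄`).  Nothing here bears on irrationality.
-/

noncomputable section

open Finset PowerSeries

namespace Summit.KontsevichZagierPeriods.Zeta5Search.SecondOrder

open Summit.KontsevichZagierPeriods.Zeta5Search.DualSeries (InBox)
open Summit.KontsevichZagierPeriods.Zeta5Search.WedgeDictionary (coeffW coeffV)
open Summit.KontsevichZagierPeriods.Zeta5Search.CasoratianValuation (InPolytope)
open Summit.KontsevichZagierPeriods.Zeta5Search.ClusterValuation
open Summit.KontsevichZagierPeriods.Zeta5Search.PadicSeries
open Summit.KontsevichZagierPeriods.Zeta5Search.CellA (classW coeffW_eq_sum_classW padicNorm_p padicNorm_pow_eq)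
open Summit.KontsevichZagierPeriods.Zeta5Search.BigPrime (padicNorm_mul_le_one)
open Summit.KontsevichZagierPeriods.Zeta5Search.CellKit (conj_level)

variable {p : ℕ} [hp : Fact p.Prime]

section Agg

variable (b : ℕ → ℤ) (hb : InPolytope b) (hp5 : 5 ≤ p) (hpn : (p : ℤ) ≤ b 0) (hwin : (b 0 + 2 : ℤ) < (p : ℤ) ^ 2)
  {M : ℕ} (hM : 6 ≤ M) (hMe : Even M) {T : List ℤ} (hT : T.reverse = T)
  (H1 : ∀ x ∈ multipoleClasses b p, -(M : ℤ) ≤ classExp b p x)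
  (H2 : ∀ y, y < p → classPoleCount b p y = 1 → -(M : ℤ) + 1 ≤ classNu b p y)
  (H3 : ∀ x ∈ multipoleClasses b p, classExp b p x = -(M : ℤ) → ¬ CentreIn b p x ∧ classTypeList b p x = T)
  (H4 : ∀ y, y < p → 1 ≤ classPoleCount b p y → classNu b p y = -(M : ℤ) + 1 →
    isRaise T (classTypeList b p y) = true ∨ (¬ (2 : ℤ) ∣ b 0 ∧ CentreIn b p y ∧ classTypeList b p y = T))
  (H5 : ∀ z, z < p → 1 ≤ classPoleCount b p z → classNu b p z = -(M : ℤ) + 2 → isRaise2 T (classTypeList b p z) = true)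
include hb hp5 hpn hwin hM hMe hT H1 H2 H3 H4 H5

omit hpn hMe hT H3 H4 H5 in
/-- **Negligible classes**: a residue outside the three live layers has `‖Ω_y‖, ‖N_y‖ ≤ p⁻³`. -/
theorem negl₃ {y : ℕ} (hy : y < p) (hD : ¬ (2 ≤ classPoleCount b p y ∧ classExp b p y = -(M : ℤ)))
    (hS : ¬ (1 ≤ classPoleCount b p y ∧ classNu b p y = -(M : ℤ) + 1))
    (hS2 : ¬ (1 ≤ classPoleCount b p y ∧ classNu b p y = -(M : ℤ) + 2)) :
    padicNorm p (classW b p y / (-(p : ℚ)) ^ (-(M : ℤ) + 3)) ≤ (p : ℚ) ^ (-(3 : ℤ)) ∧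
      padicNorm p (classV b p y / (-(p : ℚ)) ^ (-(M : ℤ))) ≤ (p : ℚ) ^ (-(3 : ℤ)) := by
  have hyr : y ∈ range p := mem_range.2 hy
  -- multipole classes: `ν = E ≥ m + 3`
  have hmult : 2 ≤ classPoleCount b p y → -(M : ℤ) + 3 ≤ classExp b p y := by
    intro h2
    have hge := H1 y (mem_filter.2 ⟨hyr, h2⟩)
    have hνE : classNu b p y = classExp b p y := by
      by_contra hne; have := (tame_of_classNu_ne b hne).1; omega
    have hne0 : classExp b p y ≠ -(M : ℤ) := fun h => hD ⟨h2, h⟩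
    have hne1 : classExp b p y ≠ -(M : ℤ) + 1 := fun h => hS ⟨by omega, by rw [hνE, h]⟩
    have hne2 : classExp b p y ≠ -(M : ℤ) + 2 := fun h => hS2 ⟨by omega, by rw [hνE, h]⟩
    omega
  refine ⟨rest3W_norm b hb hp5 hwin (by omega) hmult, rest3V_norm b hb hp5 hwin hy fun h1 => ?_⟩
  by_cases h2 : 2 ≤ classPoleCount b p y
  · exact (hmult h2).trans (CellA.classExp_le_classNu b p y)
  · have hone : classPoleCount b p y = 1 := by omega
    by_cases hνE : classNu b p y = classExp b p y
    · have hν := H2 y hy hone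
      have hne1 : classNu b p y ≠ -(M : ℤ) + 1 := fun h => hS ⟨h1, h⟩
      have hne2 : classNu b p y ≠ -(M : ℤ) + 2 := fun h => hS2 ⟨h1, h⟩
      omega
    · have := (tame_of_classNu_ne b hνE).2; omega

/-- **Every residue and its conjugate contribute a multiple of `τ(T)` (mod p³)**, with one scalar of norm `≤ p⁻¹`. -/
theorem pair₃ {x : ℕ} (hx : x < p) : ∃ a : ℚ, (padicNorm p (a * typeTauW (tTop T) (tList T)) ≤ (p : ℚ) ^ (-(1 : ℤ)) ∧
      padicNorm p (a * typeTauV (tTop T) (tList T)) ≤ (p : ℚ) ^ (-(1 : ℤ))) ∧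
    padicNorm p (classW b p x / (-(p : ℚ)) ^ (-(M : ℤ) + 3) + classW b p (conjClass b p x) / (-(p : ℚ)) ^ (-(M : ℤ) + 3)
      - a * typeTauW (tTop T) (tList T)) ≤ (p : ℚ) ^ (-(3 : ℤ)) ∧
    padicNorm p (classV b p x / (-(p : ℚ)) ^ (-(M : ℤ)) + classV b p (conjClass b p x) / (-(p : ℚ)) ^ (-(M : ℤ))
      - a * typeTauV (tTop T) (tList T)) ≤ (p : ℚ) ^ (-(3 : ℤ)) := by
  have h0 : 0 ≤ b 0 := hb.1.1
  have hp0 : 0 < p := hp.out.pos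
  have hpQ : (p : ℚ) ≠ 0 := Nat.cast_ne_zero.2 hp.out.ne_zero
  have hp2 : p ≠ 2 := by omega
  have hpn' : p ≤ (b 0).toNat := by omega
  have hme : Even (-(M : ℤ)) := ((Int.even_coe_nat M).2 hMe).neg
  have hxn := le_b0_of_lt b hpn hx
  have hx' : conjClass b p x < p := conjClass_lt b hp0 x
  have hcc : conjClass b p (conjClass b p x) = x := conjClass_conjClass b hx hpn'
  have hEc : classExp b p (conjClass b p x) = classExp b p x := classExp_conj b h0 hxn
  have hPc : classPoleCount b p (conjClass b p x) = classPoleCount b p x := classPoleCount_conj b h0 hxn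
  -- `ν = m+1` or `ν = m+2` forces `ν = E`
  have hνE : ∀ {y : ℕ} {k : ℤ}, k < 0 → classNu b p y = k → classExp b p y = k := by
    intro y k hk hν
    by_contra hne
    have := (tame_of_classNu_ne b (by rw [hν]; exact Ne.symm hne)).2; omega
  by_cases hD : 2 ≤ classPoleCount b p x ∧ classExp b p x = -(M : ℤ)
  · -- deep pair
    obtain ⟨h2, hE⟩ := hD
    obtain ⟨hc, htl⟩ := H3 x (mem_filter.2 ⟨mem_range.2 hx, h2⟩) hE
    have hpal : (classTypeList b p x).reverse = classTypeList b p x := by rw [htl]; exact hT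
    have heven : Even (classExp b p x) := by rw [hE]; exact hme
    have hodd : Odd (3 + classExp b p x) := by
      rw [hE]; obtain ⟨r, hr⟩ := hMe; exact ⟨1 - (r : ℤ), by omega⟩
    obtain ⟨-, htw, htv, -⟩ := deep_data b hb hpn hT hx hc htl hodd
    obtain ⟨hW, hV⟩ := deep_pair₃ b hb hp5 hpn hwin hx (by omega) hc hpal heven (by omega)
    rw [hE, htw] at hW
    rw [hE, htv] at hV
    have hg1 : padicNorm p (gHat b p x) ≤ 1 := padicNorm_gHat_le_one' b hp5 x
    have ha : padicNorm p (-((p : ℚ) * gHat b p x * (phiHat b p x - (p : ℚ) * (topLevel b p x : ℚ) * curvHat b p x))) ≤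
        (p : ℚ) ^ (-(1 : ℤ)) := by
      rw [padicNorm.neg, padicNorm.mul, padicNorm.mul, padicNorm_p]
      have hin : padicNorm p (phiHat b p x - (p : ℚ) * (topLevel b p x : ℚ) * curvHat b p x) ≤ 1 :=
        (padicNorm.sub (p := p)).trans (max_le (padicNorm_phiHat_le_one b hp2 x)
          (padicNorm_mul_le_one (padicNorm_mul_le_one padicNorm_p_le_one
            (by simpa using padicNorm.of_nat (p := p) (topLevel b p x))) (padicNorm_curvHat_le_one b hp2 x)))
      calc (p : ℚ) ^ (-(1 : ℤ)) * padicNorm p (gHat b p x) * _ ≤ (p : ℚ) ^ (-(1 : ℤ)) * 1 * 1 :=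
            mul_le_mul (mul_le_mul_of_nonneg_left hg1 (zpow_p_nonneg _)) hin (padicNorm.nonneg _)
              (mul_nonneg (zpow_p_nonneg _) zero_le_one)
        _ = (p : ℚ) ^ (-(1 : ℤ)) := by ring
    obtain ⟨-, -, -, hn⟩ := thmA_data b hb hwin
    have hL1 : padicNorm p (topLevel b p x : ℚ) ≤ 1 := by simpa using padicNorm.of_nat (p := p) (topLevel b p x)
    have htauW : padicNorm p (tauW b p x) ≤ 1 := by
      unfold tauW
      exact (padicNorm.sub (p := p)).trans (max_le (padicNorm_mul_le_one (by rw [padicNorm_two hp2])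
        (padicNorm_wHat2_le_one b h0 hn hp2 x)) (padicNorm_mul_le_one hL1 (LevelClass.padicNorm_wHat_le_one b h0 hn hp2 x)))
    have htauV : padicNorm p (tauV b p x) ≤ 1 := by
      unfold tauV
      exact (padicNorm.sub (p := p)).trans (max_le (padicNorm_mul_le_one (by rw [padicNorm_two hp2])
        (padicNorm_vHat2_le_one b h0 hn hp2 x)) (padicNorm_mul_le_one hL1 (LevelClass.padicNorm_vHat_le_one b h0 hn hp2)))
    refine ⟨-((p : ℚ) * gHat b p x * (phiHat b p x - (p : ℚ) * (topLevel b p x : ℚ) * curvHat b p x)), ⟨?_, ?_⟩, ?_, ?_⟩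
    · rw [← htw]; exact padicNorm_mul_le_left ha htauW
    · rw [← htv]; exact padicNorm_mul_le_left ha htauV
    · have e : classW b p x / (-(p : ℚ)) ^ (-(M : ℤ) + 3) + classW b p (conjClass b p x) / (-(p : ℚ)) ^ (-(M : ℤ) + 3)
          - -((p : ℚ) * gHat b p x * (phiHat b p x - (p : ℚ) * (topLevel b p x : ℚ) * curvHat b p x))
            * typeTauW (tTop T) (tList T) =
          classW b p x / (-(p : ℚ)) ^ (-(M : ℤ) + 3) + classW b p (conjClass b p x) / (-(p : ℚ)) ^ (-(M : ℤ) + 3)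
          + (p : ℚ) * gHat b p x * (phiHat b p x - (p : ℚ) * (topLevel b p x : ℚ) * curvHat b p x)
            * typeTauW (tTop T) (tList T) := by ring
      rw [e]; exact hW
    · have e : classV b p x / (-(p : ℚ)) ^ (-(M : ℤ)) + classV b p (conjClass b p x) / (-(p : ℚ)) ^ (-(M : ℤ))
          - -((p : ℚ) * gHat b p x * (phiHat b p x - (p : ℚ) * (topLevel b p x : ℚ) * curvHat b p x))
            * typeTauV (tTop T) (tList T) =
          classV b p x / (-(p : ℚ)) ^ (-(M : ℤ)) + classV b p (conjClass b p x) / (-(p : ℚ)) ^ (-(M : ℤ))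
          + (p : ℚ) * gHat b p x * (phiHat b p x - (p : ℚ) * (topLevel b p x : ℚ) * curvHat b p x)
            * typeTauV (tTop T) (tList T) := by ring
      rw [e]; exact hV
  by_cases hS : 1 ≤ classPoleCount b p x ∧ classNu b p x = -(M : ℤ) + 1
  · obtain ⟨h1, hν⟩ := hS
    have hE : classExp b p x = -(M : ℤ) + 1 := hνE (by omega) hν
    exact raise_pair₃ b hb hp5 hpn hwin hT hx h1 hme hE (by omega) (H4 x hx h1 hν)
  by_cases hSc : 1 ≤ classPoleCount b p (conjClass b p x) ∧ classNu b p (conjClass b p x) = -(M : ℤ) + 1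
  · obtain ⟨h1, hν⟩ := hSc
    have hE : classExp b p (conjClass b p x) = -(M : ℤ) + 1 := hνE (by omega) hν
    obtain ⟨a, ha, hW, hV⟩ := raise_pair₃ b hb hp5 hpn hwin hT hx' h1 hme hE (by omega) (H4 _ hx' h1 hν)
    rw [hcc] at hW hV
    refine ⟨a, ha, ?_, ?_⟩
    · rw [add_comm (classW b p x / _)]; exact hW
    · rw [add_comm (classV b p x / _)]; exact hV
  by_cases hS2 : 1 ≤ classPoleCount b p x ∧ classNu b p x = -(M : ℤ) + 2
  · obtain ⟨h1, hν⟩ := hS2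
    have hE : classExp b p x = -(M : ℤ) + 2 := hνE (by omega) hν
    exact double_pair₃ b hb hp5 hpn hwin hT hx h1 hme hE (by omega) (H5 x hx h1 hν)
  by_cases hS2c : 1 ≤ classPoleCount b p (conjClass b p x) ∧ classNu b p (conjClass b p x) = -(M : ℤ) + 2
  · obtain ⟨h1, hν⟩ := hS2c
    have hE : classExp b p (conjClass b p x) = -(M : ℤ) + 2 := hνE (by omega) hν
    obtain ⟨a, ha, hW, hV⟩ := double_pair₃ b hb hp5 hpn hwin hT hx' h1 hme hE (by omega) (H5 _ hx' h1 hν)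
    rw [hcc] at hW hV
    refine ⟨a, ha, ?_, ?_⟩
    · rw [add_comm (classW b p x / _)]; exact hW
    · rw [add_comm (classV b p x / _)]; exact hV
  · -- both `x` and `x̄` are negligible
    have hDc : ¬ (2 ≤ classPoleCount b p (conjClass b p x) ∧ classExp b p (conjClass b p x) = -(M : ℤ)) := by
      rw [hPc, hEc]; exact hD
    obtain ⟨hWx, hVx⟩ := negl₃ b hb hp5 hwin hM H1 H2 hx hD hS hS2
    obtain ⟨hWc, hVc⟩ := negl₃ b hb hp5 hwin hM H1 H2 hx' hDc hSc hS2c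
    refine ⟨0, ⟨by rw [zero_mul, padicNorm.zero]; exact zpow_p_nonneg _,
      by rw [zero_mul, padicNorm.zero]; exact zpow_p_nonneg _⟩, ?_, ?_⟩
    · rw [zero_mul, sub_zero]
      exact (padicNorm.nonarchimedean (p := p)).trans (max_le hWx hWc)
    · rw [zero_mul, sub_zero]
      exact (padicNorm.nonarchimedean (p := p)).trans (max_le hVx hVc)

/-- **AGGREGATION (THEOREM A⁗ for one parameter vector).**  `2·W/(−p)^{m+3} ≡ A τ_W(T)`, `2·V/(−p)^m ≡ A τ_V(T) (mod p³)`
with ONE scalar `A`, `‖A‖ ≤ p⁻¹`. -/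
theorem aggregate₄ : ∃ A : ℚ, (padicNorm p (A * typeTauW (tTop T) (tList T)) ≤ (p : ℚ) ^ (-(1 : ℤ)) ∧
      padicNorm p (A * typeTauV (tTop T) (tList T)) ≤ (p : ℚ) ^ (-(1 : ℤ))) ∧
    padicNorm p (2 * (coeffW b / (-(p : ℚ)) ^ (-(M : ℤ) + 3)) - A * typeTauW (tTop T) (tList T)) ≤ (p : ℚ) ^ (-(3 : ℤ)) ∧
    padicNorm p (2 * (coeffV b / (-(p : ℚ)) ^ (-(M : ℤ))) - A * typeTauV (tTop T) (tList T)) ≤ (p : ℚ) ^ (-(3 : ℤ)) := by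
  have hp0 : 0 < p := hp.out.pos
  have hpn' : p ≤ (b 0).toNat := by have := hb.1.1; omega
  have hpair : ∀ x ∈ range p, ∃ a : ℚ, (padicNorm p (a * typeTauW (tTop T) (tList T)) ≤ (p : ℚ) ^ (-(1 : ℤ)) ∧
      padicNorm p (a * typeTauV (tTop T) (tList T)) ≤ (p : ℚ) ^ (-(1 : ℤ))) ∧
      padicNorm p (classW b p x / (-(p : ℚ)) ^ (-(M : ℤ) + 3) + classW b p (conjClass b p x) / (-(p : ℚ)) ^ (-(M : ℤ) + 3)
        - a * typeTauW (tTop T) (tList T)) ≤ (p : ℚ) ^ (-(3 : ℤ)) ∧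
      padicNorm p (classV b p x / (-(p : ℚ)) ^ (-(M : ℤ)) + classV b p (conjClass b p x) / (-(p : ℚ)) ^ (-(M : ℤ))
        - a * typeTauV (tTop T) (tList T)) ≤ (p : ℚ) ^ (-(3 : ℤ)) :=
    fun x hx => pair₃ b hb hp5 hpn hwin hM hMe hT H1 H2 H3 H4 H5 (mem_range.1 hx)
  choose! a ha using hpair
  have hconj : ∀ y ∈ range p, conjClass b p y ∈ range p := fun y _ => mem_range.2 (conjClass_lt b hp0 y)
  refine ⟨∑ x ∈ range p, a x, ⟨?_, ?_⟩, ?_, ?_⟩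
  · rw [sum_mul]; exact padicNorm.sum_le' (fun x hx => (ha x hx).1.1) (zpow_p_nonneg _)
  · rw [sum_mul]; exact padicNorm.sum_le' (fun x hx => (ha x hx).1.2) (zpow_p_nonneg _)
  · have e : 2 * (coeffW b / (-(p : ℚ)) ^ (-(M : ℤ) + 3)) - (∑ x ∈ range p, a x) * typeTauW (tTop T) (tList T) =
        ∑ x ∈ range p, (classW b p x / (-(p : ℚ)) ^ (-(M : ℤ) + 3)
          + classW b p (conjClass b p x) / (-(p : ℚ)) ^ (-(M : ℤ) + 3) - a x * typeTauW (tTop T) (tList T)) := by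
      rw [sum_sub_distrib, sum_mul, coeffW_eq_sum_classW b hp0, sum_div,
        ← sum_conj_symm b hpn' (range p) (fun y hy => mem_range.1 hy) hconj]
    rw [e]
    exact padicNorm.sum_le' (fun x hx => (ha x hx).2.1) (zpow_p_nonneg _)
  · have e : 2 * (coeffV b / (-(p : ℚ)) ^ (-(M : ℤ))) - (∑ x ∈ range p, a x) * typeTauV (tTop T) (tList T) =
        ∑ x ∈ range p, (classV b p x / (-(p : ℚ)) ^ (-(M : ℤ))
          + classV b p (conjClass b p x) / (-(p : ℚ)) ^ (-(M : ℤ)) - a x * typeTauV (tTop T) (tList T)) := by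
      rw [sum_sub_distrib, sum_mul, coeffV_eq_sum_classV b hp0, sum_div,
        ← sum_conj_symm b hpn' (range p) (fun y hy => mem_range.1 hy) hconj]
    rw [e]
    exact padicNorm.sum_le' (fun x hx => (ha x hx).2.2) (zpow_p_nonneg _)

end Agg

end Summit.KontsevichZagierPeriods.Zeta5Search.SecondOrder

end
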